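import Summits.BirchSwinnertonDyer.BirchSwinnertonDyer.Theorems.SchneiderFreeAdditiveX3LeafIndexRegime
import Summits.BirchSwinnertonDyer.Rank1Residual.Additive.N10LowerHalfStatements
import HarnessLib

/-!
# Route `SchneiderFreeAdditiveX3` (K1 door): the rung leaf's CONTENT WINDOW — `AdditiveX3RankOneLower` follows from
# `PrintedFacts` and STEP L at ONE Heegner datum PER PAIR, asked only at the pairs with `p ∣ #Ш_an(E)`

Cell `bsd-schneider-ideate`, seat `bsd-schneider-door-c5` (prover, generation 38; `--supports
stmt-BirchSwinnertonDyer-19177 --as helper`).  Sequel of `…LeafIndexRegime.lean` (F32: the leaf's body at a pair from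
`PrintedFacts` + STEP L AT ONE DATUM) and `…LeafIndexRegimeWindow.lean` (F34: at a datum, STEP L with the `Ш(E/K)`-term
dropped is EXACTLY the joint `Ш_an`-unit window).  The route closes the rung leaf from `PrintedFacts`, Poitou–Tate and
the two branch cruxes r2/r3 via STEP L at EVERY datum of EVERY pair (`AdditiveStepLInputManinAt`, `∀∀`).  This file
records the two weakenings of that hypothesis that the leaf actually consumes:

* §1 `additiveX3RankOneLower_of_printedFacts_of_forall_exists_stepL` — **`∀∃`**: `PrintedFacts` and, for every pair
  of the door, ONE Heegner datum of the door at which STEP L holds ⟹ the leaf (no Poitou–Tate, no crux by name).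
* §2 `additiveX3RankOneLower_of_printedFacts_of_window_or_stepL` — **the content window**: `PrintedFacts` and, for
  every pair of the door, EITHER a rational value `#Ш_an(E) = q` with `ord_p q ≤ 0` (then the leaf's body is free — the
  b2b cell's `N10.missingLowerBoundAt_of_padicValRat_le_zero`, no fact at all) OR one Heegner datum with STEP L ⟹ the
  leaf.  READING: the branch cruxes r2 `PotMultBranchIMC` / r3 `GordTwoBranchIMC` — hence Keller–Yin's preprint
  divisibility [DIV.dvd] — are consumed by the rung leaf ONLY on the CONTENT WINDOW `p ∣ #Ш_an(E)` of the door
  (census of this generation, kit j336347, HOME memos/census-door-c5-g38/: the window's size on the 7 101 pairs).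
* §3 `missingLowerBoundAt_of_shaAn_window` — bookkeeping: on the window's complement the leaf's body at the pair is
  unconditional.

HONEST FRAMING.  CONDITIONAL theorems (`PrintedFacts` = thirteen published facts, item 19184); the per-pair data
(`#Ш_an(E)` as a rational with its valuation; a datum with STEP L) are hypotheses, not assertions; the class-level leaf,
the cruxes and the target 19175 are untouched; no item closes; BSD is proved for no curve.
References: Miller 2011 Def. 1.1 [Miller2011LMS]; Jetchev–Skinner–Wan 2017 §7.4.1 [JetchevSkinnerWan2017]; Gross–Zagier
1986 I.(6.3) [GrossZagier1986]; this route p447721/p448348 (leaf chain), p748362 (F32), p748997 (F34).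
-/

set_option autoImplicit false
-- `Summit.<P>.<Sub>` repeats `BirchSwinnertonDyer` by the tree's layout convention (D-0017)
set_option linter.dupNamespace false

noncomputable section

open scoped Classical

open Field NumberField IsDedekindDomain WeierstrassCurve
open Literature.NumberTheory.EllipticCurves Literature.NumberTheory.EllipticCurves.ModularForms
  Literature.NumberTheory.EllipticCurves.Rank1Residual Literature.NumberTheory.EllipticCurves.Rank1Residual.Typed
  Summit.BirchSwinnertonDyer.Rank1Residual Summit.BirchSwinnertonDyer.Rank1Residual.X11b
  Summit.BirchSwinnertonDyer.BirchSwinnertonDyer.Theorems.SchneiderFree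
  Summit.BirchSwinnertonDyer.BirchSwinnertonDyer.Theses.SchneiderFreeAdditiveX3

namespace Summit.BirchSwinnertonDyer.BirchSwinnertonDyer.Theorems.SchneiderFreeAdditiveX3.LeafIndexRegime

/-! ### §1 The `∀∃` form of the leaf chain -/

/-- **The rung leaf from `PrintedFacts` and STEP L at ONE datum per pair (`∀∃`).**  The route's chain
(`…ControlLeMinimal.additiveX3RankOneLower_of_printedFacts_of_pt_of_branchIMCs`) feeds STEP L at every datum (`∀∀`, via
the target `AdditiveStepLInputManinAt`); the leaf needs it at one.  CONDITIONAL on `PrintedFacts`; the `∀∃` hypothesis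
is not asserted. [cite: JetchevSkinnerWan2017, §7.4.1 (arXiv:1512.06894 p. 30)] [cite: GrossZagier1986, Thm. I.(6.3)] -/
theorem additiveX3RankOneLower_of_printedFacts_of_forall_exists_stepL (hF : PrintedFacts)
    (hL : ∀ (W : WeierstrassCurve ℚ) [W.IsElliptic] [W.IsGloballyMinimal] (p : ℕ) [Fact p.Prime],
      W.analyticRank = 1 → p ≠ 2 → ClassX3 W p → Additive.SubSemistableTwist W p →
      (∃ (N : ℕ) (_ : NeZero N) (K : Type) (_ : Field K) (_ : NumberField K)
        (Dt : ModularParametrizationData W N) (H : HeegnerDatum N (NumberField.discr K)) (ι : K →+* ℂ)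
        (P : (W.baseChange K).toAffine.Point),
        W.conductorNorm ℤ = N ∧ IsImaginaryQuadratic K ∧ Odd (NumberField.discr K) ∧
        ¬ p ∣ Units.torsionOrder K ∧ SatisfiesHeegnerHypothesis N K ∧
        (W.quadraticTwist (NumberField.discr K : ℚ)).entireLFunction 1 ≠ 0 ∧
        WeierstrassCurve.Affine.Point.map ι.toRatAlgHom P = heegnerPointComplex Dt H ∧
        ¬ IsOfFinAddOrder P ∧ IndexLowerBoundLeAt W p K P (padicValNat p Dt.c.natAbs))) :
    Summit.BirchSwinnertonDyer.BirchSwinnertonDyer.Theorems.SchneiderFree.AdditiveX3RankOneLower := by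
  intro W _ _ p _ hr hp2 hX hS
  obtain ⟨N, _, K, _, _, Dt, H, ι, P, hN, hK, hodd, hunit, hHe, hLt, hP, hnt, hidx⟩ := hL W p hr hp2 hX hS
  exact missingLowerBoundAt_of_printedFacts_of_indexLowerBoundLeAt hF W p hr hp2 hX hS N K Dt H ι P hN hK hodd hunit
    hHe hLt hP hnt hidx

/-! ### §2 The content window -/

/-- **The rung leaf from `PrintedFacts`, asking STEP L only on the CONTENT WINDOW `p ∣ #Ш_an(E)`.**  For every pair of
the door: either `#Ш_an(E)` is a rational `q` with `ord_p q ≤ 0` — then the leaf's body `MissingLowerBoundAt W p` holds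
with NO input (b2b's `N10.missingLowerBoundAt_of_padicValRat_le_zero`) — or a Heegner datum with STEP L is supplied
(where the branch cruxes r2/r3 are consumed).  CONDITIONAL on `PrintedFacts`; the per-pair disjunction is a hypothesis.
[cite: Miller2011LMS, Def. 1.1] [cite: JetchevSkinnerWan2017, §7.4.1 (arXiv:1512.06894 p. 30)] -/
theorem additiveX3RankOneLower_of_printedFacts_of_window_or_stepL (hF : PrintedFacts)
    (hWL : ∀ (W : WeierstrassCurve ℚ) [W.IsElliptic] [W.IsGloballyMinimal] (p : ℕ) [Fact p.Prime],
      W.analyticRank = 1 → p ≠ 2 → ClassX3 W p → Additive.SubSemistableTwist W p →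
      (∃ q : ℚ, shaAn W = (q : ℂ) ∧ padicValRat p q ≤ 0) ∨
      (∃ (N : ℕ) (_ : NeZero N) (K : Type) (_ : Field K) (_ : NumberField K)
        (Dt : ModularParametrizationData W N) (H : HeegnerDatum N (NumberField.discr K)) (ι : K →+* ℂ)
        (P : (W.baseChange K).toAffine.Point),
        W.conductorNorm ℤ = N ∧ IsImaginaryQuadratic K ∧ Odd (NumberField.discr K) ∧
        ¬ p ∣ Units.torsionOrder K ∧ SatisfiesHeegnerHypothesis N K ∧
        (W.quadraticTwist (NumberField.discr K : ℚ)).entireLFunction 1 ≠ 0 ∧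
        WeierstrassCurve.Affine.Point.map ι.toRatAlgHom P = heegnerPointComplex Dt H ∧
        ¬ IsOfFinAddOrder P ∧ IndexLowerBoundLeAt W p K P (padicValNat p Dt.c.natAbs))) :
    Summit.BirchSwinnertonDyer.BirchSwinnertonDyer.Theorems.SchneiderFree.AdditiveX3RankOneLower := by
  intro W _ _ p _ hr hp2 hX hS
  rcases hWL W p hr hp2 hX hS with ⟨q, hq, hv⟩ | ⟨N, _, K, _, _, Dt, H, ι, P, hN, hK, hodd, hunit, hHe, hLt, hP, hnt, hidx⟩
  · exact Additive.N10.missingLowerBoundAt_of_padicValRat_le_zero W p hq hv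
  · exact missingLowerBoundAt_of_printedFacts_of_indexLowerBoundLeAt hF W p hr hp2 hX hS N K Dt H ι P hN hK hodd hunit
      hHe hLt hP hnt hidx

/-! ### §3 Off the window the body is unconditional -/

/-- **Off the content window the leaf's body at the pair is a theorem with no hypothesis** (restated for the door's
ledger: at a pair with `#Ш_an(E) = q`, `ord_p q ≤ 0`, `MissingLowerBoundAt W p` needs neither `PrintedFacts` nor any
datum).  [cite: Miller2011LMS, Def. 1.1] -/
theorem missingLowerBoundAt_of_shaAn_window (W : WeierstrassCurve ℚ) [W.IsElliptic] [W.IsGloballyMinimal]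
    (p : ℕ) [Fact p.Prime] {q : ℚ} (hq : shaAn W = (q : ℂ)) (hv : padicValRat p q ≤ 0) :
    MissingLowerBoundAt W p :=
  Additive.N10.missingLowerBoundAt_of_padicValRat_le_zero W p hq hv

end Summit.BirchSwinnertonDyer.BirchSwinnertonDyer.Theorems.SchneiderFreeAdditiveX3.LeafIndexRegime

end
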